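import Summits.QuantumAdvantage.QuantumAdvantage.Theorems.WbwObfuscatedGluedTreesKowRiVocabulary

/-!
# `WbwObfuscatedGluedTrees` (stmt-QuantumAdvantage-2340) — line `knowledge-of-walk-split`, STAGE 6:
# stub `stub_cycleRatio` (the cylinder ratio for the ideal-II code cycle)

Crux stmt-QuantumAdvantage-2340 (`WbwObfuscatedGluedTrees`, informal), line `knowledge-of-walk-split`, stage 6 (the
real → ideal statistical layer, vocabulary `WbwObfuscatedGluedTreesKowRiVocabulary`), registered stub `stub_cycleRatio`.

The ideal-II cycle datum `codeCycle (Hn, Hc) d` is the pair of the generator's four-round Feistel permutations of the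
leaf positions `Fin 2^d`, run over the two cycle tables `Hc.1`, `Hc.2` (the naming tables `Hn` are not read).  Taking as
HYPOTHESES the statements of the two neighbouring stubs —
* `stub_lr4Ratio` (Luby–Rackoff 1988, Theorem 2, as a coefficient-H ratio): for the abstract four-round Feistel `psi`
  over a uniform key, every cylinder event `Cyl L` has probability at least `(1 − lrSlack a b |L|)` times its probability
  under a uniformly random permutation of `{0,1}^a × {0,1}^b`;
* `stub_prpTable` (the format bridge): the generator's `prp` over the table scheme is `psi` of the effective key of the
  selected table, conjugated by `splitVec`/`joinVec`, and all fibres of `H ↦ effKey H d` have the same size for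
  `d + 8 ≤ μ` —
this file transports the ratio to the PAIR of code permutations against a uniformly random cycle datum:
`(1 − 2·lrSlack ⌊d/2⌋ ⌈d/2⌉ (2t)) · Pr_{σ}[Cyl L₁ σ.1 ∧ Cyl L₂ σ.2] ≤ Pr_{Hc}[Cyl L₁ (codeCycle (Hn,Hc) d).1 ∧ Cyl L₂ (…).2]`
for constraint lists of length `≤ 2t`.  Ingredients (§1): independence of the two factors under the uniform law on a
product, invariance of uniform probabilities under an equivalence (here: conjugation of permutations by
`Fin 2^d ≃ {0,1}^{⌊d/2⌋} × {0,1}^{⌈d/2⌉}`), push-forward of the uniform law along an equidistributed map; (§2) cylinders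
under conjugation and the elementary `(1 − s)² ≥ 1 − 2s`, assembled into an abstract core; (§3) the code permutations
are conjugates of `psi` of the effective keys, and the stub.
-/

set_option linter.dupNamespace false

noncomputable section

namespace Summit.QuantumAdvantage.QuantumAdvantage.Theorems.WbwObfuscatedGluedTrees.KnowledgeOfWalk.RealIdeal

open Literature.Computability.Complexity Literature.Computability.QuantumComplexity
open Literature.Computability.QuantumComplexity.GluedTrees
open Literature.Computability.Cryptography Literature.Computability.Cryptography.ObfuscatedGluedTrees
open Summit.QuantumAdvantage.QuantumAdvantage.Theorems.WbwObfuscatedGluedTrees.KnowledgeOfWalk.BlackBox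
open Literature.Computability.Cryptography.LubyRackoff (finProb_uniform)

/-! ## §1 Uniform probabilities on finite types: products, equivalences, equidistributed maps -/

/-- Under the uniform law on a product of finite types, events on the two factors are independent:
`Pr[E p.1 ∧ F p.2] = Pr[E] · Pr[F]`. [folklore] -/
theorem finProb_uniform_prod_and {X Y : Type} [Fintype X] [Fintype Y] [Nonempty X] [Nonempty Y]
    (E : X → Prop) (F : Y → Prop) :
    finProb (PMF.uniformOfFintype (X × Y)) (fun p => E p.1 ∧ F p.2) =
      finProb (PMF.uniformOfFintype X) E * finProb (PMF.uniformOfFintype Y) F := by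
  classical
  rw [finProb_uniform, finProb_uniform, finProb_uniform, Fintype.card_prod, ← Finset.univ_product_univ,
    Finset.filter_product, Finset.card_product]
  push_cast
  rw [div_mul_div_comm]

/-- Uniform probabilities of events that correspond under an equivalence of finite types agree. [folklore] -/
theorem finProb_uniform_equiv {X Y : Type} [Fintype X] [Fintype Y] [Nonempty X] [Nonempty Y] (φ : X ≃ Y)
    (E : X → Prop) (F : Y → Prop) (h : ∀ x, E x ↔ F (φ x)) :
    finProb (PMF.uniformOfFintype X) E = finProb (PMF.uniformOfFintype Y) F := by
  classical
  rw [finProb_uniform, finProb_uniform, Fintype.card_congr φ, Finset.filter_congr fun x _ => h x,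
    ← Finset.map_univ_equiv φ, Finset.filter_map, Finset.card_map]
  rfl

/-- Push-forward of the uniform law along an EQUIDISTRIBUTED map: if all fibres of `g : X → K` have the same size
(`#g⁻¹(k) · |K| = |X|` for every `k`), then `Pr_{x}[E (g x)] = Pr_{k}[E k]`. [folklore] -/
theorem finProb_uniform_comp_of_fibres {X K : Type} [Fintype X] [Fintype K] [Nonempty X] [Nonempty K]
    [DecidableEq K] (g : X → K)
    (hfib : ∀ k, (Finset.univ.filter fun x => g x = k).card * Fintype.card K = Fintype.card X) (E : K → Prop) :
    finProb (PMF.uniformOfFintype X) (fun x => E (g x)) = finProb (PMF.uniformOfFintype K) E := by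
  classical
  have hX : (0 : ℝ) < Fintype.card X := by exact_mod_cast Fintype.card_pos
  have hK : (0 : ℝ) < Fintype.card K := by exact_mod_cast Fintype.card_pos
  have hmaps : Set.MapsTo g ↑(Finset.univ.filter fun x => E (g x)) ↑(Finset.univ.filter E) :=
    fun x hx => by simpa using hx
  have hcount : (Finset.univ.filter fun x => E (g x)).card * Fintype.card K =
      (Finset.univ.filter E).card * Fintype.card X := by
    rw [Finset.card_eq_sum_card_fiberwise hmaps, Finset.sum_mul]
    rw [Finset.sum_congr rfl fun k hk => ?_, Finset.sum_const, smul_eq_mul]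
    have hEk : E k := by simpa using hk
    rw [← hfib k, Finset.filter_filter]
    congr 2
    exact Finset.filter_congr fun x _ => ⟨fun hx => hx.2, fun hx => ⟨hx ▸ hEk, hx⟩⟩
  rw [finProb_uniform, finProb_uniform, div_eq_div_iff hX.ne' hK.ne']
  exact_mod_cast hcount

/-! ## §2 Cylinders under conjugation, the elementary inequality, and the abstract core -/

/-- A cylinder event for a conjugate `e⁻¹ ∘ f ∘ e` is the transported cylinder event for `f`. [folklore] -/
theorem cyl_conj_iff {α β : Type} (e : α ≃ β) (L : List (α × α)) {g : α → α} {f : β → β}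
    (hg : ∀ x, g x = e.symm (f (e x))) : Cyl L g ↔ Cyl (L.map fun p => (e p.1, e p.2)) f := by
  simp only [Cyl, List.forall_mem_map, hg, Equiv.symm_apply_eq]

/-- Conjugating by an equivalence `e : α ≃ β` preserves the uniform probability of cylinder events on permutations:
`Pr_{π ∈ Perm α}[Cyl L π] = Pr_{π' ∈ Perm β}[Cyl (e × e)(L) π']`. [folklore] -/
theorem finProb_cyl_permCongr {α β : Type} [Fintype α] [DecidableEq α] [Fintype β] [DecidableEq β] (e : α ≃ β)
    (L : List (α × α)) :
    finProb (PMF.uniformOfFintype (Equiv.Perm α)) (fun π => Cyl L π) =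
      finProb (PMF.uniformOfFintype (Equiv.Perm β)) (fun π => Cyl (L.map fun p => (e p.1, e p.2)) π) :=
  finProb_uniform_equiv e.permCongr _ _ fun π => by
    simp only [Cyl, List.forall_mem_map, Equiv.permCongr_apply, Equiv.symm_apply_apply, Equiv.apply_eq_iff_eq]

/-- The slack is monotone in the number of constraints. [folklore] -/
theorem lrSlack_mono (a b : ℕ) {q q' : ℕ} (h : q ≤ q') : lrSlack a b q ≤ lrSlack a b q' := by
  unfold lrSlack
  gcongr

/-- Multiplying two ratio bounds: `(1 − s₁)P₁ ≤ Q₁`, `(1 − s₂)P₂ ≤ Q₂` with `s₁, s₂ ≤ s` and `0 ≤ Pᵢ, Qᵢ` give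
`(1 − 2s)·P₁P₂ ≤ Q₁Q₂` (via `(1 − s)² = 1 − 2s + s²`). [folklore] -/
theorem ratio_mul_combine {s s₁ s₂ P₁ P₂ Q₁ Q₂ : ℝ} (h₁ : s₁ ≤ s) (h₂ : s₂ ≤ s)
    (hP₁ : 0 ≤ P₁) (hP₂ : 0 ≤ P₂) (hQ₁ : 0 ≤ Q₁) (hQ₂ : 0 ≤ Q₂)
    (hr₁ : (1 - s₁) * P₁ ≤ Q₁) (hr₂ : (1 - s₂) * P₂ ≤ Q₂) :
    (1 - 2 * s) * (P₁ * P₂) ≤ Q₁ * Q₂ := by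
  have hr₁' : (1 - s) * P₁ ≤ Q₁ := le_trans (mul_le_mul_of_nonneg_right (by linarith) hP₁) hr₁
  have hr₂' : (1 - s) * P₂ ≤ Q₂ := le_trans (mul_le_mul_of_nonneg_right (by linarith) hP₂) hr₂
  by_cases hs1 : 1 - s ≤ 0
  · calc (1 - 2 * s) * (P₁ * P₂) ≤ 0 := mul_nonpos_of_nonpos_of_nonneg (by linarith) (mul_nonneg hP₁ hP₂)
      _ ≤ Q₁ * Q₂ := mul_nonneg hQ₁ hQ₂
  · push Not at hs1
    calc (1 - 2 * s) * (P₁ * P₂) ≤ (1 - s) ^ 2 * (P₁ * P₂) :=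
          mul_le_mul_of_nonneg_right (by nlinarith [sq_nonneg s]) (mul_nonneg hP₁ hP₂)
      _ = ((1 - s) * P₁) * ((1 - s) * P₂) := by ring
      _ ≤ Q₁ * Q₂ := mul_le_mul hr₁' hr₂' (mul_nonneg hs1.le hP₂) hQ₁

/-- **The abstract core.**  Permutations of `α`, an equivalence `e : α ≃ β`, a keyed family `ψ k` of maps of `β`
(the Feistel network) over a finite key space `K`, and an equidistributed key extraction `κ : X → K` (the effective key
of a table).  If for the transported constraint lists the keyed family satisfies the ratio bounds
`(1 − sᵢ)·Pr_{π' ∈ Perm β}[Cyl] ≤ Pr_{k}[Cyl (ψ k)]` with `sᵢ ≤ s`, then the pair of conjugates `e⁻¹ ∘ ψ (κ xᵢ) ∘ e`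
over a uniform pair `(x₁, x₂)` satisfies `(1 − 2s)·Pr_{(π₁,π₂)}[Cyl L₁ π₁ ∧ Cyl L₂ π₂] ≤ Pr_{(x₁,x₂)}[…]`. [folklore] -/
theorem cycleRatio_core {α β X K : Type} [Fintype α] [DecidableEq α] [Fintype β] [DecidableEq β]
    [Fintype X] [Nonempty X] [Fintype K] [Nonempty K] [DecidableEq K]
    (e : α ≃ β) (ψ : K → β → β) (κ : X → K)
    (hfib : ∀ k, (Finset.univ.filter fun x => κ x = k).card * Fintype.card K = Fintype.card X)
    {s s₁ s₂ : ℝ} (h₁ : s₁ ≤ s) (h₂ : s₂ ≤ s) (L₁ L₂ : List (α × α))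
    (hr₁ : (1 - s₁) *
        finProb (PMF.uniformOfFintype (Equiv.Perm β)) (fun π => Cyl (L₁.map fun p => (e p.1, e p.2)) π) ≤
      finProb (PMF.uniformOfFintype K) (fun k => Cyl (L₁.map fun p => (e p.1, e p.2)) (ψ k)))
    (hr₂ : (1 - s₂) *
        finProb (PMF.uniformOfFintype (Equiv.Perm β)) (fun π => Cyl (L₂.map fun p => (e p.1, e p.2)) π) ≤
      finProb (PMF.uniformOfFintype K) (fun k => Cyl (L₂.map fun p => (e p.1, e p.2)) (ψ k))) :
    (1 - 2 * s) * finProb (PMF.uniformOfFintype (Equiv.Perm α × Equiv.Perm α)) (fun σ => Cyl L₁ σ.1 ∧ Cyl L₂ σ.2) ≤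
      finProb (PMF.uniformOfFintype (X × X)) (fun p => Cyl (L₁.map fun p => (e p.1, e p.2)) (ψ (κ p.1)) ∧
        Cyl (L₂.map fun p => (e p.1, e p.2)) (ψ (κ p.2))) := by
  have hP := finProb_uniform_prod_and (fun π : Equiv.Perm α => Cyl L₁ π) (fun π : Equiv.Perm α => Cyl L₂ π)
  have hQ := finProb_uniform_prod_and (fun x : X => Cyl (L₁.map fun p => (e p.1, e p.2)) (ψ (κ x)))
    (fun x : X => Cyl (L₂.map fun p => (e p.1, e p.2)) (ψ (κ x)))
  rw [hP, hQ, finProb_cyl_permCongr e L₁, finProb_cyl_permCongr e L₂,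
    finProb_uniform_comp_of_fibres κ hfib fun k => Cyl (L₁.map fun p => (e p.1, e p.2)) (ψ k),
    finProb_uniform_comp_of_fibres κ hfib fun k => Cyl (L₂.map fun p => (e p.1, e p.2)) (ψ k)]
  exact ratio_mul_combine h₁ h₂ (finProb_nonneg _ _) (finProb_nonneg _ _) (finProb_nonneg _ _) (finProb_nonneg _ _)
    hr₁ hr₂

/-! ## §3 The code permutations are conjugates of `psi`, and the stub -/

/-- `splitEquiv d` is `splitVec d`. [folklore] -/
@[simp] theorem splitEquiv_apply (d : ℕ) (w : Fin d → Bool) : splitEquiv d w = splitVec d w := rfl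

/-- `(splitEquiv d)⁻¹` is `joinVec d`. [folklore] -/
@[simp] theorem splitEquiv_symm_apply (d : ℕ) (p : (Fin (d / 2) → Bool) × (Fin (d - d / 2) → Bool)) :
    (splitEquiv d).symm p = joinVec d p := rfl

/-- Under the format bridge `prp (tabScheme H) μ (tkey i) d = joinVec ∘ psi (effKey (H.tab i) d) ∘ splitVec`, the two
code permutations of `codeCycle (Hn, Hc) d` are the conjugates by `e := bitVecEquiv⁻¹ ≫ splitEquiv : Fin 2^d ≃ halves`
of `psi` of the effective keys of the two cycle tables `Hc.1`, `Hc.2`. [cite: LubyRackoff1988, main construction] -/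
theorem codeCycle_apply_of_bridge
    (hprp : ∀ (μ d : ℕ) (H : CodeSpace μ) (i : Fin 4) (w : Fin d → Bool),
      prp (tabScheme H) μ (tkey i) d w = joinVec d (psi (effKey (H.tab i) d) (splitVec d w)))
    {μ : ℕ} (Hn Hc : PrfTable μ × PrfTable μ) (d : ℕ) (x : Fin (2 ^ d)) :
    (codeCycle (Hn, Hc) d).1 x = ((bitVecEquiv d).symm.trans (splitEquiv d)).symm
        (psi (effKey Hc.1 d) (((bitVecEquiv d).symm.trans (splitEquiv d)) x)) ∧
      (codeCycle (Hn, Hc) d).2 x = ((bitVecEquiv d).symm.trans (splitEquiv d)).symm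
        (psi (effKey Hc.2 d) (((bitVecEquiv d).symm.trans (splitEquiv d)) x)) := by
  constructor
  · simp only [codeCycle, cycleOf, leafPerm, Equiv.permCongr_apply, hprp, CodeSpace.tab_two,
      Equiv.symm_trans_apply, Equiv.trans_apply, Equiv.symm_symm, splitEquiv_apply, splitEquiv_symm_apply]
  · simp only [codeCycle, cycleOf, leafPerm, Equiv.permCongr_apply, hprp, CodeSpace.tab_three,
      Equiv.symm_trans_apply, Equiv.trans_apply, Equiv.symm_symm, splitEquiv_apply, splitEquiv_symm_apply]

open Classical in
/-- **Stub `stub_cycleRatio`** (the cylinder ratio for the ideal-II code cycle).  Assuming (1) the abstract Luby–Rackoff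
ratio for the four-round Feistel `psi` (statement of stub `stub_lr4Ratio`) and (2) the format bridge and the
equidistribution of effective keys (statement of stub `stub_prpTable`): for `d + 8 ≤ μ`, any naming tables `Hn` and
constraint lists `L₁, L₂` of length `≤ 2t`,
`(1 − 2·lrSlack ⌊d/2⌋ ⌈d/2⌉ (2t)) · Pr_{σ}[Cyl L₁ σ.1 ∧ Cyl L₂ σ.2] ≤ Pr_{Hc}[Cyl L₁ (codeCycle (Hn,Hc) d).1 ∧ Cyl L₂ (codeCycle (Hn,Hc) d).2]`.
Proof: both sides factorise over the two independent coordinates; the table side pushes forward along `effKey` to a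
uniform Luby–Rackoff key and its cylinder is the `e`-transported cylinder of `psi`; the uniform side is invariant under
conjugation by `e`; then (1) for each factor, `lrSlack` being monotone in `q`, and `(1 − s)² ≥ 1 − 2s`.
[cite: LubyRackoff1988, Theorem 2 (strong pseudorandomness of four rounds)] -/
theorem stub_cycleRatio : ∀ (μ d t : ℕ), d + 8 ≤ μ →
    (∀ (a b : ℕ) (L : List (((Fin a → Bool) × (Fin b → Bool)) × ((Fin a → Bool) × (Fin b → Bool)))),
      (1 - lrSlack a b L.length) *
          finProb (PMF.uniformOfFintype (Equiv.Perm ((Fin a → Bool) × (Fin b → Bool)))) (fun π => Cyl L π) ≤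
        finProb (PMF.uniformOfFintype (LRKey a b)) (fun f => Cyl L (psi f))) →
    ((∀ (μ d : ℕ) (H : CodeSpace μ) (i : Fin 4) (w : Fin d → Bool),
        prp (tabScheme H) μ (tkey i) d w = joinVec d (psi (effKey (H.tab i) d) (splitVec d w))) ∧
      (∀ (μ d : ℕ), d + 8 ≤ μ → ∀ e : LRKey (d / 2) (d - d / 2),
        (Finset.univ.filter fun H : PrfTable μ => effKey H d = e).card * Fintype.card (LRKey (d / 2) (d - d / 2)) =
          Fintype.card (PrfTable μ))) →
    ∀ (Hn : PrfTable μ × PrfTable μ) (L₁ L₂ : List (Fin (2 ^ d) × Fin (2 ^ d))),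
      L₁.length ≤ 2 * t → L₂.length ≤ 2 * t →
      (1 - 2 * lrSlack (d / 2) (d - d / 2) (2 * t)) *
          finProb (PMF.uniformOfFintype (CycleDatum d)) (fun σ => Cyl L₁ σ.1 ∧ Cyl L₂ σ.2) ≤
        finProb (PMF.uniformOfFintype (PrfTable μ × PrfTable μ))
          (fun Hc => Cyl L₁ (codeCycle (Hn, Hc) d).1 ∧ Cyl L₂ (codeCycle (Hn, Hc) d).2) := by
  classical
  intro μ d t hμ hLR hPT Hn L₁ L₂ hL₁ hL₂
  have hcode := codeCycle_apply_of_bridge hPT.1 Hn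
  rw [finProb_congr (PMF.uniformOfFintype (PrfTable μ × PrfTable μ)) fun Hc =>
    and_congr (cyl_conj_iff ((bitVecEquiv d).symm.trans (splitEquiv d)) L₁ fun x => (hcode Hc d x).1)
      (cyl_conj_iff ((bitVecEquiv d).symm.trans (splitEquiv d)) L₂ fun x => (hcode Hc d x).2)]
  exact cycleRatio_core ((bitVecEquiv d).symm.trans (splitEquiv d)) psi (fun H : PrfTable μ => effKey H d)
    (hPT.2 μ d hμ) (lrSlack_mono (d / 2) (d - d / 2) (q' := 2 * t) (by simpa using hL₁))
    (lrSlack_mono (d / 2) (d - d / 2) (q' := 2 * t) (by simpa using hL₂)) L₁ L₂ (hLR _ _ _) (hLR _ _ _)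

end Summit.QuantumAdvantage.QuantumAdvantage.Theorems.WbwObfuscatedGluedTrees.KnowledgeOfWalk.RealIdeal

end
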